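import Literature.Geometry.DiscreteGeometry.KissingSearchCheck
import HarnessLib

/-!
# The run of the kissing growth search, part 44 of 128 (computational, `native_decide`)

Topic `Literature/Geometry/DiscreteGeometry`; provefact brick for `Hales2012_contactGraphTame` /
`Hales2012_contactGraphFccOrHcp`.  The whole computation `∀ i < 128, checkPart 5 128 i 60 = true`
(`KissingSearchCheck.lean`: the `17556` states of the search frontier at depth `5` below the `14`
root states, split round-robin into `128` parts, each state searched with fuel `60`) is run by
`native_decide`, one part per file, in `KissingSearchRun000.lean` … `KissingSearchRun127.lean`;
the parts are assembled in `KissingSearchFinal.lean` (`concl_of_parts`, `KissingSearchRoot.lean`).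
About `2.07 · 10⁶` search nodes in all (`≈ 1.6 · 10⁴` per part; an independent C++
implementation of the same search agrees node for node and finds only the FCC and HCP patterns).

## References
* T. C. Hales, arXiv:1209.6043 (2012), Theorem 3 and Lemma 8 (computer-assisted classification
  of the tame contact hypermaps, here re-done as a verified growth search). [`Hales2012`]
-/

namespace Literature.Geometry.DiscreteGeometry

namespace KissingSearch

/-- **Part `44` of `128` of the growth search returns `true`** (frontier depth `5`, fuel `60`).
[cite: Hales2012, Theorem 3 and Lemma 8] -/
theorem checkPart_eq_true_044 : checkPart 5 128 44 60 = true := by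
  native_decide

end KissingSearch

end Literature.Geometry.DiscreteGeometry
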